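import Summits.RiemannHypothesis.RiemannHypothesis.Theses.IntegerScrew
import Literature.NumberTheory.LFunctions.ZetaScrewProofs
import HarnessLib

/-!
# Crux `ScrewPolyFloor` (stmt-RiemannHypothesis-15757) — negative lemma: the sign `0 < c` carries ALL the content

LOAD-BEARING ANALYSIS of the hypothesis `0 < c`.  The crux is
`∃ A c : ℝ, 0 < c ∧ ∀ M x, c · M^{-A} · Σ_{2 ≤ m ≤ M} x_m² ≤ x·S_M·x`.  With `0 < c` DROPPED
(so `c ≤ 0` and any real `A` are admitted) the statement is an UNCONDITIONAL THEOREM with no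
arithmetic content (`screwPolyFloor_anySign_holds`): by Suzuki2023 Thm 1.1(3)
(`Suzuki2023_thm11_growth_holds`, RH-free) `|Ψ(t)| ≤ K e^{|t|}`, so every entry of `S_M` is at most
`3KM` in absolute value, `|x·S_M·x| ≤ 3KM · (Σ|x_m|)² ≤ 3K M² Σ x_m²`, and the pair
`A = -2`, `c = -3K` satisfies the inequality.  So the crux is exactly "the sign of the floor":
everything RH-strength in it (`IntegerScrew.screwPolyFloor_iff_riemannHypothesis`) enters through
`0 < c`; in particular no argument that is insensitive to the sign of `c` (norm bounds, growth
bounds, Gershgorin-type estimates on `|G|`) can prove it.  Refuter, cdisprove cycle 1.  Theorems only.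
-/

noncomputable section

namespace Summit.RiemannHypothesis.Cruxes.ScrewPolyFloor.Negative

open Literature.NumberTheory.LFunctions
open scoped BigOperators

/-- Global exponential bound for Suzuki's screw function, from the RH-free growth theorem
Suzuki2023 Thm 1.1(3) (`|Ψ(t)| ≤ K e^{t/2 - c√t}` for `t > 0`), evenness and `Ψ(0) = 0`:
`|Ψ(t)| ≤ K e^{|t|}` for every real `t`, with `K ≥ 0`. -/
theorem exists_abs_zetaScrew_le_exp :
    ∃ K : ℝ, 0 ≤ K ∧ ∀ t : ℝ, |zetaScrew t| ≤ K * Real.exp |t| := by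
  obtain ⟨c, hc, K, hK⟩ := Suzuki2023_thm11_growth_holds
  refine ⟨max K 0, le_max_right _ _, fun t => ?_⟩
  rcases eq_or_ne t 0 with rfl | ht
  · simp only [zetaScrew_zero, abs_zero, Real.exp_zero, mul_one]
    exact le_max_right _ _
  · have hpos : 0 < |t| := abs_pos.2 ht
    have h := hK |t| hpos
    rw [zetaScrew_abs] at h
    have hsq : 0 ≤ c * Real.sqrt |t| := by positivity
    calc |zetaScrew t| ≤ K * Real.exp (|t| / 2 - c * Real.sqrt |t|) := h
      _ ≤ max K 0 * Real.exp (|t| / 2 - c * Real.sqrt |t|) :=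
          mul_le_mul_of_nonneg_right (le_max_left _ _) (Real.exp_pos _).le
      _ ≤ max K 0 * Real.exp |t| := by
          apply mul_le_mul_of_nonneg_left _ (le_max_right _ _)
          apply Real.exp_le_exp.2
          linarith [abs_nonneg t]

/-- Entry bound: for `2 ≤ m, m' ≤ M`, `|G(log m, log m')| ≤ 3KM` (each of the three `Ψ`-values is
at most `K · e^{log M} = KM` in absolute value). -/
theorem abs_zetaScrewKernel_log_le {K : ℝ} (hK0 : 0 ≤ K)
    (hK : ∀ t : ℝ, |zetaScrew t| ≤ K * Real.exp |t|) {M m m' : ℕ}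
    (hm : m ∈ Finset.Icc 2 M) (hm' : m' ∈ Finset.Icc 2 M) :
    |zetaScrewKernel (Real.log m) (Real.log m')| ≤ 3 * K * M := by
  simp only [Finset.mem_Icc] at hm hm'
  have hm1 : (1 : ℝ) ≤ m := by exact_mod_cast (by omega : 1 ≤ m)
  have hm'1 : (1 : ℝ) ≤ m' := by exact_mod_cast (by omega : 1 ≤ m')
  have hmM : (m : ℝ) ≤ M := by exact_mod_cast hm.2
  have hm'M : (m' : ℝ) ≤ M := by exact_mod_cast hm'.2
  have hMpos : (0 : ℝ) < M := by linarith
  have hlm : 0 ≤ Real.log m := Real.log_nonneg hm1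
  have hlm' : 0 ≤ Real.log m' := Real.log_nonneg hm'1
  have hlmM : Real.log m ≤ Real.log M := Real.log_le_log (by linarith) hmM
  have hlm'M : Real.log m' ≤ Real.log M := Real.log_le_log (by linarith) hm'M
  -- the three values
  have h1 : |zetaScrew (Real.log m)| ≤ K * M := by
    refine (hK _).trans ?_
    rw [abs_of_nonneg hlm, Real.exp_log (by linarith)]
    exact mul_le_mul_of_nonneg_left hmM hK0
  have h2 : |zetaScrew (Real.log m')| ≤ K * M := by
    refine (hK _).trans ?_
    rw [abs_of_nonneg hlm', Real.exp_log (by linarith)]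
    exact mul_le_mul_of_nonneg_left hm'M hK0
  have h3 : |zetaScrew (Real.log m - Real.log m')| ≤ K * M := by
    refine (hK _).trans ?_
    have habs : |Real.log m - Real.log m'| ≤ Real.log M := by
      rw [abs_sub_le_iff]; constructor <;> linarith
    calc K * Real.exp |Real.log m - Real.log m'| ≤ K * Real.exp (Real.log M) :=
          mul_le_mul_of_nonneg_left (Real.exp_le_exp.2 habs) hK0
      _ = K * M := by rw [Real.exp_log hMpos]
  rw [zetaScrewKernel_def]
  calc |zetaScrew (Real.log m) + zetaScrew (Real.log m') - zetaScrew (Real.log m - Real.log m')|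
      ≤ |zetaScrew (Real.log m) + zetaScrew (Real.log m')| +
          |zetaScrew (Real.log m - Real.log m')| := abs_sub _ _
    _ ≤ |zetaScrew (Real.log m)| + |zetaScrew (Real.log m')| +
          |zetaScrew (Real.log m - Real.log m')| := by
        gcongr; exact abs_add_le _ _
    _ ≤ K * M + K * M + K * M := by gcongr
    _ = 3 * K * M := by ring

/-- Form bound: `|x·S_M·x| ≤ 3K · M² · Σ_{2 ≤ m ≤ M} x_m²` (entry bound, `(Σ|x_m|)² ≤ #s · Σ x_m²`,
`#(Icc 2 M) ≤ M`). -/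
theorem abs_screwForm_le {K : ℝ} (hK0 : 0 ≤ K)
    (hK : ∀ t : ℝ, |zetaScrew t| ≤ K * Real.exp |t|) (M : ℕ) (x : ℕ → ℝ) :
    |∑ m ∈ Finset.Icc 2 M, ∑ m' ∈ Finset.Icc 2 M,
        zetaScrewKernel (Real.log m) (Real.log m') * (x m * x m')| ≤
      3 * K * (M : ℝ) ^ 2 * ∑ m ∈ Finset.Icc 2 M, x m ^ 2 := by
  set s := Finset.Icc 2 M with hs
  have hcard : (s.card : ℝ) ≤ M := by
    rw [hs, Nat.card_Icc]
    exact_mod_cast (by omega : M + 1 - 2 ≤ M)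
  have hM0 : (0 : ℝ) ≤ M := Nat.cast_nonneg M
  have hsq0 : 0 ≤ ∑ m ∈ s, x m ^ 2 := Finset.sum_nonneg fun m _ => sq_nonneg _
  calc |∑ m ∈ s, ∑ m' ∈ s, zetaScrewKernel (Real.log m) (Real.log m') * (x m * x m')|
      ≤ ∑ m ∈ s, |∑ m' ∈ s, zetaScrewKernel (Real.log m) (Real.log m') * (x m * x m')| :=
        Finset.abs_sum_le_sum_abs _ _
    _ ≤ ∑ m ∈ s, ∑ m' ∈ s, |zetaScrewKernel (Real.log m) (Real.log m') * (x m * x m')| :=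
        Finset.sum_le_sum fun m _ => Finset.abs_sum_le_sum_abs _ _
    _ ≤ ∑ m ∈ s, ∑ m' ∈ s, 3 * K * M * (|x m| * |x m'|) := by
        refine Finset.sum_le_sum fun m hm => Finset.sum_le_sum fun m' hm' => ?_
        rw [abs_mul, abs_mul]
        exact mul_le_mul_of_nonneg_right (abs_zetaScrewKernel_log_le hK0 hK hm hm')
          (by positivity)
    _ = 3 * K * M * (∑ m ∈ s, |x m|) ^ 2 := by
        rw [sq, Finset.sum_mul_sum, Finset.mul_sum]
        refine Finset.sum_congr rfl fun m _ => ?_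
        rw [Finset.mul_sum]
    _ ≤ 3 * K * M * ((s.card : ℝ) * ∑ m ∈ s, |x m| ^ 2) :=
        mul_le_mul_of_nonneg_left sq_sum_le_card_mul_sum_sq (by positivity)
    _ = 3 * K * M * ((s.card : ℝ) * ∑ m ∈ s, x m ^ 2) := by simp_rw [sq_abs]
    _ ≤ 3 * K * M * ((M : ℝ) * ∑ m ∈ s, x m ^ 2) := by
        apply mul_le_mul_of_nonneg_left _ (by positivity)
        exact mul_le_mul_of_nonneg_right hcard hsq0
    _ = 3 * K * (M : ℝ) ^ 2 * ∑ m ∈ s, x m ^ 2 := by ring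

/-- **Dropping `0 < c` makes the crux an unconditional theorem.**  The statement of
`ScrewPolyFloor` with the conjunct `0 < c` removed holds with the witness `A = -2`, `c = -3K`
(RH-free; from the growth bound only).  Hence the hypothesis `0 < c` is where the entire
(RH-equivalent) content of the crux sits. -/
theorem screwPolyFloor_anySign_holds :
    ∃ A c : ℝ, ∀ (M : ℕ) (x : ℕ → ℝ),
      c * (M : ℝ) ^ (-A) * ∑ m ∈ Finset.Icc 2 M, x m ^ 2 ≤
        ∑ m ∈ Finset.Icc 2 M, ∑ m' ∈ Finset.Icc 2 M,
          zetaScrewKernel (Real.log m) (Real.log m') * (x m * x m') := by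
  obtain ⟨K, hK0, hK⟩ := exists_abs_zetaScrew_le_exp
  refine ⟨-2, -(3 * K), fun M x => ?_⟩
  have hpow : (M : ℝ) ^ (-(-2 : ℝ)) = (M : ℝ) ^ 2 := by rw [neg_neg, Real.rpow_two]
  rw [hpow]
  have h := abs_screwForm_le hK0 hK M x
  have h' := neg_abs_le (∑ m ∈ Finset.Icc 2 M, ∑ m' ∈ Finset.Icc 2 M,
    zetaScrewKernel (Real.log m) (Real.log m') * (x m * x m'))
  linarith

/-- The same with the sign made explicit: the crux's inequality holds for SOME NON-POSITIVE `c`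
(trivially), so `ScrewPolyFloor` is equivalent to its own restriction to `0 < c` — which is the
Riemann hypothesis (`IntegerScrew.screwPolyFloor_iff_riemannHypothesis`). -/
theorem screwPolyFloor_nonpos_sign_holds :
    ∃ A c : ℝ, c ≤ 0 ∧ ∀ (M : ℕ) (x : ℕ → ℝ),
      c * (M : ℝ) ^ (-A) * ∑ m ∈ Finset.Icc 2 M, x m ^ 2 ≤
        ∑ m ∈ Finset.Icc 2 M, ∑ m' ∈ Finset.Icc 2 M,
          zetaScrewKernel (Real.log m) (Real.log m') * (x m * x m') := by
  obtain ⟨K, hK0, hK⟩ := exists_abs_zetaScrew_le_exp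
  refine ⟨-2, -(3 * K), by linarith, fun M x => ?_⟩
  have hpow : (M : ℝ) ^ (-(-2 : ℝ)) = (M : ℝ) ^ 2 := by rw [neg_neg, Real.rpow_two]
  rw [hpow]
  have h := abs_screwForm_le hK0 hK M x
  have h' := neg_abs_le (∑ m ∈ Finset.Icc 2 M, ∑ m' ∈ Finset.Icc 2 M,
    zetaScrewKernel (Real.log m) (Real.log m') * (x m * x m'))
  linarith

end Summit.RiemannHypothesis.Cruxes.ScrewPolyFloor.Negative

end
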